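import Literature.AlgebraicGeometry.ShimuraVarieties.UnitaryAuxiliaryTorusDatum
import Literature.NumberTheory.ComplexMultiplication.ReflexNormArtinMap
import Literature.NumberTheory.AdelicBaseChange.AdeleNormGalois
import Literature.NumberTheory.AdelicBaseChange.FiniteAdeleGaloisDescent
import HarnessLib

/-!
# The finite reflex norm lands in the auxiliary torus: `N_Φ(s) · N_Φ(s)^ρ = N_{k/ℚ}(s)` on finite idèles
# (Shimura (19.7b) / Milne CM Rem. 1.24 (b) (10), finite part) — glue g4 of the `hodgecm-mathlib` cell

Topic `AlgebraicGeometry/ShimuraVarieties`, sequel of `UnitaryAuxiliaryTorusDatum` (B-typ03, p590143: the auxiliary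
torus `T₀ = {t ∈ Res_{L/ℚ} 𝔾_m | t·t̄ ∈ 𝔾_{m,ℚ}}`, `Aux.torusFinAdelic L ≤ 𝔸_{L,f}^×`, and the enlarged reflex field
`E♯ = Aux.reflexField L Φ τ`).  THEOREMS ONLY (no definition, no named fact; D-0026 net debt 0).

THE PRINT.  G. Shimura, *Abelian Varieties with Complex Multiplication and Modular Functions* (1998), §19.7
(19.7b) p. 134: «`f(x) f(x)^ρ = N_{k/ℚ}(x)` (`x ∈ k_𝐀^×`)», with (18.5c) p. 123 «`g(a) g(a)^ρ = N_{K*/ℚ}(a)`»;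
J. S. Milne, *Complex Multiplication*, Ch. I §1 Rem. 1.24 (b) (10) p. 16 «for any `ℚ`-algebra `R`,
`N_{k,Φ}(a) · ι_E N_{k,Φ}(a) = Nm_{k⊗R/R}(a)`» and Rem. 1.25 p. 17 «Equation (10) shows that the homomorphism
`N_{k,Φ} : T^k → T^E` factors through `T = 𝔾_m ×_{T^F} T^E`».  The tree proves (19.7b) on FULL adèles and idèles
with the conjugation `ρ` DEFINED through `𝔸_ℚ ⊗_ℚ K = 𝔸_K` (`reflexNormAdele_mul_adeleComplexConj`,
`reflexNormIdele_mul_ideleComplexConj_mem_range`, file `…ComplexMultiplication/ReflexNormIdelesNormRelation`), and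
recorded as its DEVIATION (i) that the agreement of this `ρ` with the place-by-place Galois action on `𝔸_K`
(`…Automorphic/GaloisActionAdeleRing`, the conjugation `UnitaryGroup.conjFiniteAdele` in which `Aux.torusFinAdelic`
is written) was NOT proved.  This file closes that gap and reads (19.7b) on FINITE idèles in the currency of
`Aux.torusFinAdelic`:

* §1 `adeleComplexConj_eq_smul` — **the tensor conjugation `x ↦ x^ρ` of `…NormRelation` IS the componentwise
  Galois action** of `ρ` (as a `ℚ`-automorphism of `K`) on `𝔸_K` [Cassels–Fröhlich VII (Tate) §7.1 «`G` acts on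
  `L ⊗_K A_K` by `σ ⊗ 1` … `(σx)_{σw} = σ_w x_w`», the tree's `smul_adeleRingTensorAlgEquiv` at base `ℚ`]; hence on
  finite parts `(x^ρ)_f = conjFiniteAdele K⁺ K ρ (x_f)` (`snd_adeleComplexConj_eq_conjFiniteAdele`, through the tree's
  `restrictScalars_smul_finiteAdeleRing`: the actions of `ρ ∈ Gal(K/K⁺)` and of `ρ|^ℚ ∈ Aut(K/ℚ)` agree), and
  `…ReflexNormArtinMap`'s finite `ι_E` is `c ⊗ 1` too (`finiteAdeleComplexConj_eq_conjFiniteAdele`,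
  `coe_finiteIdeleComplexConj_eq_conjFiniteAdele`).
* §2 `reflexNormFiniteAdele_mul_conjFiniteAdele` — **(19.7b) ON FINITE ADÈLES/IDÈLES**:
  `g_f(s) · (c ⊗ 1)(g_f(s)) = con_f(N_{k/ℚ,f}(s))` in `𝔸_{K,f}` for `k ⊇ E*` (`g_f = reflexNormFiniteAdele`,
  `N_{k/ℚ,f} = finiteAdeleRelNorm ℚ k`, `con_f = FiniteAdeleRing.baseChange (𝓞 ℚ) ℚ K (𝓞 K)`): the finite component
  of the tree's adelic (19.7b) at the adèle `(1, s)`, with `(N x)_f = N_f(x_f)` (`snd_adeleRelNorm`) and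
  `(con r)_f = con_f(r_f)` (`NumberField.AdeleRing.baseChange_snd_apply`, `finiteAdeleRing_mapSemialgHom_apply_eq_baseChange`).
* §3 `Aux.reflexNormFiniteIdele_mem_torusFinAdelic` — **Rem. 1.25 for `T₀`**: for every number field
  `k ⊇ E* = traceField Φ` inside `ℂ` and every finite idèle `s` of `k`, `N_{k,Φ,f}(s) ∈ T₀(𝔸_f) = Aux.torusFinAdelic L`,
  with similitude factor `N_{k/ℚ,f}(s)` (`…_of_le`); in particular at `k = E♯ = Aux.reflexField L Φ τ`
  (`Aux.reflexNormFiniteIdele_mem_torusFinAdelic`, the hypothesis `hg4` of B-plan2's `auxQuotientDescent_of`,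
  skeleton `B1HeckeQuotientDescent.lean` v4 §6, now a theorem).

## References
* [Shimura1998] G. Shimura, *Abelian Varieties with Complex Multiplication and Modular Functions*, Princeton 1998,
  §18.5 (18.5c) p. 123; §19.7 (19.7b) p. 134.
* [MilneCM2006] J. S. Milne, *Complex Multiplication* (course notes), Ch. I §1 Rem. 1.24 (b) (10) p. 16, Rem. 1.25 p. 17.
* [CasselsFrohlichANT1967] Cassels–Fröhlich, *Algebraic Number Theory*, Ch. II §14 (14.2), §19 (19.7); Ch. VII §7.1.
-/

set_option autoImplicit false

noncomputable section

open scoped TensorProduct NumberField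

open NumberField IsDedekindDomain

/-! ## §1 The tensor conjugation on `𝔸_K` is the componentwise Galois action -/

namespace Literature.NumberTheory.ComplexMultiplication

open Literature.NumberTheory.AdelicBaseChange

section Conj

variable (K : Type) [Field K] [NumberField K] [IsCMField K]

/-- **`x^ρ = ρ • x` on `𝔸_K`**: the conjugation `adeleComplexConj K` of `…ReflexNormIdelesNormRelation`
(`1 ⊗ ρ` on `𝔸_ℚ ⊗_ℚ K` transported along (14.2)) is the componentwise action
(`…Automorphic/GaloisActionAdeleRing`) of `ρ`, regarded as a `ℚ`-algebra automorphism of `K`, on the adèle ring —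
Tate's «`G` acts on `L ⊗_K A_K` by `σ ⊗ 1`; […] `(σx)_{σw} = σ_w x_w`» at `K = ℚ`, `L = K`, `σ = ρ`
(the tree's `smul_adeleRingTensorAlgEquiv`).  Closes DEVIATION (i) of `…ReflexNormIdelesNormRelation`.
[cite: CasselsFrohlichANT1967, Ch. VII §7.1] -/
theorem adeleComplexConj_eq_smul (x : AdeleRing (𝓞 K) K) :
    adeleComplexConj K x = ((IsCMField.complexConj K).restrictScalars ℚ) • x := by
  obtain ⟨z, rfl⟩ := (ratAdeleTensorEquiv K).surjective x
  rw [adeleComplexConj_ratAdeleTensorEquiv]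
  -- `ratAdeleTensorEquiv K` is (the underlying map of) `adeleRingTensorAlgEquiv ℚ K`, definitionally
  change adeleRingTensorAlgEquiv ℚ K (conjPoints K (AdeleRing (𝓞 ℚ) ℚ) z) =
    ((IsCMField.complexConj K).restrictScalars ℚ) • adeleRingTensorAlgEquiv ℚ K z
  rw [smul_adeleRingTensorAlgEquiv]
  -- `conjPoints K R = 1 ⊗ ρ` is `Algebra.TensorProduct.map (AlgHom.id R R) ρ` by definition
  congr 1

/-- **On finite parts `(x^ρ)_f = (c ⊗ 1)(x_f)`**: the finite component of the tensor conjugation is the tree's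
`UnitaryGroup.conjFiniteAdele K⁺ K ρ` (the componentwise action of `ρ ∈ Gal(K/K⁺)` on `𝔸_{K,f}`, in which
`UnitaryGroup.finAdelic` and `Aux.torusFinAdelic` are written) — §1 plus the agreement of the actions of `ρ` and of
`ρ|^ℚ` (`restrictScalars_smul_finiteAdeleRing`). [cite: CasselsFrohlichANT1967, Ch. VII §7.1] -/
theorem snd_adeleComplexConj_eq_conjFiniteAdele (x : AdeleRing (𝓞 K) K) :
    (adeleComplexConj K x).2 =
      Literature.NumberTheory.Automorphic.UnitaryGroup.conjFiniteAdele (↥(maximalRealSubfield K)) K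
        (IsCMField.complexConj K) x.2 := by
  rw [adeleComplexConj_eq_smul, Literature.NumberTheory.Automorphic.AdeleRing.smul_snd,
    restrictScalars_smul_finiteAdeleRing, Literature.NumberTheory.Automorphic.UnitaryGroup.conjFiniteAdele_apply]

/-- **`ι_E` on `𝔸_{K,f}` IS `c ⊗ 1`**: the finite tensor conjugation `finiteAdeleComplexConj K` of
`…ReflexNormArtinMap` (Milne's `ι_E` on `𝔸_{f,E}`, `1 ⊗ ρ` on `𝔸_{ℚ,f} ⊗_ℚ K`) equals the tree's componentwise
`UnitaryGroup.conjFiniteAdele K⁺ K ρ`. [cite: CasselsFrohlichANT1967, Ch. VII §7.1] [cite: MilneCM2006, Ch. II §9, Lemma 9.7] -/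
theorem finiteAdeleComplexConj_eq_conjFiniteAdele (y : FiniteAdeleRing (𝓞 K) K) :
    finiteAdeleComplexConj K y =
      Literature.NumberTheory.Automorphic.UnitaryGroup.conjFiniteAdele (↥(maximalRealSubfield K)) K
        (IsCMField.complexConj K) y := by
  rw [finiteAdeleComplexConj_eq_snd, snd_adeleComplexConj_eq_conjFiniteAdele]

/-- The same on finite idèles: `(ι_E s : 𝔸_{K,f}) = (c ⊗ 1)(s)` for `finiteIdeleComplexConj K`.
[cite: MilneCM2006, Ch. II §9, Lemma 9.7] -/
theorem coe_finiteIdeleComplexConj_eq_conjFiniteAdele (s : (FiniteAdeleRing (𝓞 K) K)ˣ) :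
    ((finiteIdeleComplexConj K s : (FiniteAdeleRing (𝓞 K) K)ˣ) : FiniteAdeleRing (𝓞 K) K) =
      Literature.NumberTheory.Automorphic.UnitaryGroup.conjFiniteAdele (↥(maximalRealSubfield K)) K
        (IsCMField.complexConj K) (s : FiniteAdeleRing (𝓞 K) K) := by
  rw [coe_finiteIdeleComplexConj, finiteAdeleComplexConj_eq_conjFiniteAdele]

end Conj

/-! ## §2 Shimura (19.7b) on finite adèles and finite idèles -/

section FiniteNormRelation

variable (K : Type) [Field K] [NumberField K] [IsCMField K] (Φ : Literature.AlgebraicGeometry.Motives.CMType K)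
  (k : IntermediateField ℚ ℂ) [NumberField k]

/-- **(19.7b) ON FINITE ADÈLES: `g_f(y) · (c ⊗ 1)(g_f(y)) = con_f(N_{k/ℚ,f}(y))` in `𝔸_{K,f}`** for every finite
adèle `y` of a number field `k ⊇ E*` (`g_f = reflexNormFiniteAdele K Φ k`, `c ⊗ 1 = conjFiniteAdele K⁺ K ρ`,
`N_{k/ℚ,f} = finiteAdeleRelNorm ℚ k` = Cassels's (19.7) on `𝔸_{k,f}`, `con_f` the base change of finite adèles from
`ℚ` to `K`): the finite component of the tree's adelic identity `reflexNormAdele_mul_adeleComplexConj` at the adèle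
`(1, y)`. [cite: Shimura1998, §19.7 (19.7b) p. 134] [cite: MilneCM2006, Ch. I §1 Rem. 1.24 (b) (10)] -/
theorem reflexNormFiniteAdele_mul_conjFiniteAdele (hk : traceField Φ ≤ k) (y : FiniteAdeleRing (𝓞 k) k) :
    reflexNormFiniteAdele K Φ k y *
        Literature.NumberTheory.Automorphic.UnitaryGroup.conjFiniteAdele (↥(maximalRealSubfield K)) K
          (IsCMField.complexConj K) (reflexNormFiniteAdele K Φ k y) =
      Literature.NumberTheory.Automorphic.FiniteAdeleRing.baseChange (𝓞 ℚ) ℚ K (𝓞 K)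
        (finiteAdeleRelNorm ℚ k y) := by
  have h := congrArg Prod.snd
    (reflexNormAdele_mul_adeleComplexConj K Φ k hk ((1, y) : AdeleRing (𝓞 k) k))
  rw [NumberField.AdeleRing.mul_snd, snd_adeleComplexConj_eq_conjFiniteAdele, snd_reflexNormAdele,
    NumberField.AdeleRing.baseChange_snd_apply, finiteAdeleRing_mapSemialgHom_apply_eq_baseChange,
    snd_adeleRelNorm] at h
  exact h

/-- **(19.7b) ON FINITE IDÈLES**, units form: `g_f(s) · (c ⊗ 1)(g_f(s)) = con_f(N_{k/ℚ,f}(s))` with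
`N_{k/ℚ,f}(s) = finiteIdeleRelNorm ℚ k s ∈ 𝔸_{ℚ,f}^×`. [cite: Shimura1998, §19.7 (19.7b) p. 134] -/
theorem reflexNormFiniteIdele_mul_conjFiniteAdele (hk : traceField Φ ≤ k) (s : (FiniteAdeleRing (𝓞 k) k)ˣ) :
    (reflexNormFiniteIdele K Φ k s : FiniteAdeleRing (𝓞 K) K) *
        Literature.NumberTheory.Automorphic.UnitaryGroup.conjFiniteAdele (↥(maximalRealSubfield K)) K
          (IsCMField.complexConj K) (reflexNormFiniteIdele K Φ k s) =
      Literature.NumberTheory.Automorphic.FiniteAdeleRing.baseChange (𝓞 ℚ) ℚ K (𝓞 K)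
        ((finiteIdeleRelNorm ℚ k s : (FiniteAdeleRing (𝓞 ℚ) ℚ)ˣ) : FiniteAdeleRing (𝓞 ℚ) ℚ) := by
  rw [coe_reflexNormFiniteIdele, coe_finiteIdeleRelNorm]
  exact reflexNormFiniteAdele_mul_conjFiniteAdele K Φ k hk (s : FiniteAdeleRing (𝓞 k) k)

end FiniteNormRelation

end Literature.NumberTheory.ComplexMultiplication

/-! ## §3 The finite reflex norm lands in `T₀(𝔸_f)` (Milne Rem. 1.25 for the auxiliary torus) -/

namespace Literature.AlgebraicGeometry.ShimuraVarieties.UnitaryCanonicalModel.Aux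

open Literature.AlgebraicGeometry.Motives (CMType)
open Literature.NumberTheory.ComplexMultiplication
open Literature.NumberTheory.AdelicBaseChange (finiteIdeleRelNorm)

variable (L : Type) [Field L] [NumberField L] [IsCMField L] (Φ : CMType L)

/-- **`N_{k,Φ,f}(s) ∈ T₀(𝔸_f)` for every number field `k ⊇ E*`** and every finite idèle `s` of `k`, with
similitude factor `N_{k/ℚ,f}(s)`: Milne's «the homomorphism `N_{k,Φ} : T^k → T^E` factors through
`T = 𝔾_m ×_{T^F} T^E`» (Rem. 1.25), read on `𝔸_f`-points in the currency of `Aux.torusFinAdelic`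
(`z · (c ⊗ 1)(z) = con_f(q)`, `q ∈ 𝔸_{ℚ,f}^×`) — §2. [cite: MilneCM2006, Ch. I §1 Rem. 1.25 p. 17] [cite: Shimura1998, §19.7 (19.7b) p. 134] -/
theorem reflexNormFiniteIdele_mem_torusFinAdelic_of_le (k : IntermediateField ℚ ℂ) [NumberField k]
    (hk : traceField Φ ≤ k) (s : (FiniteAdeleRing (𝓞 k) k)ˣ) :
    reflexNormFiniteIdele L Φ k s ∈ torusFinAdelic L :=
  ⟨finiteIdeleRelNorm ℚ k s, reflexNormFiniteIdele_mul_conjFiniteAdele L Φ k hk s⟩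

omit [IsCMField L] in
/-- `E* ≤ E♯`: the trace field of `Φ` lies in the enlarged reflex field `E♯ = τ(L) · E*`. [cite: Liu2021, App. C Lem. C.14 (p. 113)] -/
theorem traceField_le_reflexField (τ : L →+* ℂ) : traceField Φ ≤ reflexField L Φ τ :=
  le_sup_right

/-- **Glue g4 of the `hodgecm-mathlib` cell: `N_{E♯,Φ,f}(s) ∈ T₀(𝔸_f)` for every finite idèle `s` of
`E♯ = Aux.reflexField L Φ τ`** — the hypothesis `hg4` of B-plan2's `auxQuotientDescent_of` (finite Hecke quotient
descent on the auxiliary carriers), as a theorem. [cite: MilneCM2006, Ch. I §1 Rem. 1.25 p. 17] [cite: Shimura1998, §19.7 (19.7b) p. 134] -/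
theorem reflexNormFiniteIdele_mem_torusFinAdelic (τ : L →+* ℂ) :
    haveI := numberField_reflexField L Φ τ
    ∀ s : (FiniteAdeleRing (𝓞 ↥(reflexField L Φ τ)) ↥(reflexField L Φ τ))ˣ,
      reflexNormFiniteIdele L Φ (reflexField L Φ τ) s ∈ torusFinAdelic L := by
  haveI := numberField_reflexField L Φ τ
  exact fun s =>
    reflexNormFiniteIdele_mem_torusFinAdelic_of_le L Φ (reflexField L Φ τ) (traceField_le_reflexField L Φ τ) s

end Literature.AlgebraicGeometry.ShimuraVarieties.UnitaryCanonicalModel.Aux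

end
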